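import Mathlib

/-!
# SoloBlindWeightOneLock — the root-system half of LEMMA V (PROPOSITION W, the weight-one lock):
# `ρ_n ⊥ Δ_c`, central parameters are `W`-fixed, and a `Δ_c`-singular vector is never
# `W_c`-conjugate to a `Δ_c`-regular one

Solo seat `solo-Langlands-blind`, session 26; companion of `SoloBlindNoncompactRoots` /
`SoloBlindWeylDivisibility` (T0(5)).  New mathematics of this seat is only the ASSEMBLY
(`weightOneLock`); every step is elementary root-system algebra over Mathlib's `RootPairing`.

Dictionary.  `(H, X)` a Shimura datum, `h ∈ X`, `K_h = Cent(h) ⊆ H(ℝ)` (so `H(ℝ)` has a compact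
Cartan subgroup `T ⊆ K_h`: equal rank), `P` = the root system `Φ(𝔥_ℂ, 𝔱_ℂ)` (take `R = ℚ`, `M = X^*(T)_ℚ`),
`cpt : ι → Prop` = the COMPACT roots `Φ_c = Φ(𝔨_ℂ, 𝔱_ℂ)` (closed under their own reflections:
hypothesis `hcc`), `pos : Finset ι` = the roots of `𝔭⁺` (the holomorphic tangent space; `Ad K_h`
preserves `𝔭⁺`, so every compact reflection permutes `pos`: hypothesis `hstab`),
`twoRhoN pos = Σ_{β ∈ Φ(𝔭⁺)} β = 2ρ_n`, `W = ⟨s_α : α ∈ Φ⟩`, `W_c = ⟨s_α : α ∈ Φ_c⟩`.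
An archimedean component `π_∞` is of ARTIN TYPE when its infinitesimal character `λ` is CENTRAL:
`⟨λ, α^∨⟩ = 0` for every root (hypothesis `hcent`, stated for `lam = 2λ`, which is central too).

The analytic input that is NOT formalised here is Casselman–Osborne [CO75, Thm. 2.6] (as used in
[Har90, (4.3.2)]): for a `Z(𝔥)`-finite `(𝔥, K_h)`-module `π` with generalised infinitesimal
character `λ`, every generalised `Z(𝔨)`-character occurring in `H^q(𝔭^-, π)` (resp. `H^q(𝔭^+, π)`)
has Harish-Chandra representative in `{wλ + ρ_n : w ∈ W}` (resp. `{wλ - ρ_n}`), while an irreducible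
`K_h`-type of highest weight `μ` has `Z(𝔨)`-character `μ + ρ_c`, which is `Δ_c`-REGULAR
(`⟨μ + ρ_c, α^∨⟩ > 0` on `Φ_c^+`); two representatives give the same `Z(𝔨)`-character iff they are
`W_c`-conjugate.  Doubling everything (`x = w(2λ) ± 2ρ_n`, `y = 2(μ + ρ_c)`) changes neither
orthogonality nor regularity nor `W_c`-conjugacy.

What is proved (kernel): (1) `coroot'_eq_zero_of_reflection_eq` — a vector fixed by `s_α` is
orthogonal to `α^∨`; (2) `reflection_twoRhoN`, `coroot'_twoRhoN_eq_zero` — `K_h`-stability of `𝔭⁺`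
gives `s_α(2ρ_n) = 2ρ_n`, hence `⟨2ρ_n, α^∨⟩ = 0` for every compact `α` (`ρ_n ⊥ Δ_c`);
(3) `weyl_apply_eq_self_of_central` — a central `λ` is fixed by all of `W`; (4)
`regular_iff_of_mem_compactWeyl` — `Δ_c`-regularity is `W_c`-invariant; (5) `weightOneLock` — if
`Φ_c ≠ ∅` then for every `w ∈ W`, `v ∈ W_c` and every `Δ_c`-regular `y`:
`v y ≠ w(2λ) + 2ρ_n` and `v y ≠ w(2λ) - 2ρ_n`.  With [CO75] this is LEMMA V of the seat's paper
(§5 item 15): an Artin-type `π_∞` has `Hom_{K_h}(V_τ, H^q(𝔭^±, π_∞)) = 0` for every `K_h`-type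
`τ` and every `q`, i.e. `H^q(𝔓_h, K_h; π_∞ ⊗ V) = 0` for every `P_h`-representation `V`, on every
Shimura host whose `K_h` has a root (everything except products of discs / units of quaternion
algebras split at the real places in question); by [Su18, Thm. (main)]
(`H^i(Sh_{K,Σ}, Ṽ^can) ≅ H^i_{(𝔭_h,K_h)}(𝒜(H)^K ⊗ V)`, Hecke-equivariantly, ALL automorphic forms)
the `χ_λ`-primary part of the coherent cohomology of every canonically extended automorphic
vector bundle then vanishes for central `λ`.

[cite: CasselmanOsborne1975, Thm. 2.6] [cite: Harris1990JDG, (4.3.2) p. 31]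
[cite: Su2018CoherentCohomology, arXiv:1810.12056, Thm. (main) p. 3]
[cite: CarayolKnapp2007, Trans. AMS 359, abstract p. 1]
-/

namespace Summit.Langlands.Langlands.Theorems.SoloBlind

open Function

variable {ι R M N : Type*} [CommRing R] [AddCommGroup M] [Module R M]
  [AddCommGroup N] [Module R N] (P : RootPairing ι R M N)

/-- `2ρ_n`: the sum of the roots of `𝔭⁺`, indexed by the finset `pos`. -/
def twoRhoN (pos : Finset ι) : M := ∑ j ∈ pos, P.root j

/-- (1) A vector fixed by the reflection `s_i` is orthogonal to the coroot `α_i^∨`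
(`R` a domain of characteristic zero). -/
theorem coroot'_eq_zero_of_reflection_eq [IsDomain R] [CharZero R] {i : ι} {x : M} (hx : P.reflection i x = x) :
    P.coroot' i x = 0 := by
  have h : P.coroot' i (P.reflection i x) = -P.coroot' i x := by
    rw [P.reflection_apply, map_sub, map_smul, P.coroot_root_two, smul_eq_mul]
    ring
  rw [hx] at h
  have h2 : (2 : R) * P.coroot' i x = 0 := by linear_combination h
  rcases mul_eq_zero.mp h2 with h3 | h3
  · exact absurd h3 two_ne_zero
  · exact h3

/-- (2a) If the compact reflection `s_i` permutes the roots of `𝔭⁺` (`Ad K_h` preserves `𝔭⁺`), then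
`s_i (2ρ_n) = 2ρ_n`. -/
theorem reflection_twoRhoN (pos : Finset ι) {i : ι}
    (hstab : ∀ j ∈ pos, P.reflectionPerm i j ∈ pos) :
    P.reflection i (twoRhoN P pos) = twoRhoN P pos := by
  have hiff : ∀ j, j ∈ pos ↔ P.reflectionPerm i j ∈ pos := fun j =>
    ⟨hstab j, fun h => by simpa using hstab _ h⟩
  unfold twoRhoN
  rw [map_sum]
  simp_rw [← P.root_reflectionPerm]
  exact Finset.sum_equiv (P.reflectionPerm i) hiff (fun j _ => rfl)

/-- (2b) `ρ_n ⊥ Δ_c`: `⟨2ρ_n, α_i^∨⟩ = 0` for every (compact) root `α_i` whose reflection permutes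
the roots of `𝔭⁺`. -/
theorem coroot'_twoRhoN_eq_zero [IsDomain R] [CharZero R] (pos : Finset ι) {i : ι}
    (hstab : ∀ j ∈ pos, P.reflectionPerm i j ∈ pos) :
    P.coroot' i (twoRhoN P pos) = 0 :=
  coroot'_eq_zero_of_reflection_eq P (reflection_twoRhoN P pos hstab)

/-- (3a) A central vector (orthogonal to every coroot) is fixed by every reflection … -/
theorem reflection_apply_eq_self_of_central {lam : M} (hcent : ∀ k, P.coroot' k lam = 0) (k : ι) :
    P.reflection k lam = lam := by
  rw [P.reflection_apply, hcent, zero_smul, sub_zero]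

/-- (3b) … hence by every element of the Weyl group `W = ⟨s_α⟩` (so Casselman–Osborne's `wλ` is
`λ` for Artin type). -/
theorem weyl_apply_eq_self_of_central {lam : M} (hcent : ∀ k, P.coroot' k lam = 0)
    {w : M ≃ₗ[R] M} (hw : w ∈ Subgroup.closure (Set.range P.reflection)) : w lam = lam := by
  induction hw using Subgroup.closure_induction with
  | mem x hx =>
    obtain ⟨k, rfl⟩ := hx
    exact reflection_apply_eq_self_of_central P hcent k
  | one => rfl
  | mul x z _ _ ihx ihz => rw [LinearEquiv.mul_apply, ihz, ihx]
  | inv x _ ih =>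
    calc x⁻¹ lam = x⁻¹ (x lam) := by rw [ih]
      _ = lam := by rw [← LinearEquiv.mul_apply, inv_mul_cancel]; rfl

/-- (3c) The Casselman–Osborne side is `Δ_c`-singular: for central `lam` (= `2λ`), any `w ∈ W` and any
compact `α_i` permuting `Φ(𝔭⁺)`, both `w lam + 2ρ_n` and `w lam - 2ρ_n` are orthogonal to `α_i^∨`. -/
theorem coroot'_casselmanOsborne_eq_zero [IsDomain R] [CharZero R] (pos : Finset ι) {lam : M}
    (hcent : ∀ k, P.coroot' k lam = 0) {w : M ≃ₗ[R] M}
    (hw : w ∈ Subgroup.closure (Set.range P.reflection)) {i : ι}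
    (hstab : ∀ j ∈ pos, P.reflectionPerm i j ∈ pos) :
    P.coroot' i (w lam + twoRhoN P pos) = 0 ∧ P.coroot' i (w lam - twoRhoN P pos) = 0 := by
  rw [weyl_apply_eq_self_of_central P hcent hw, map_add, map_sub, hcent i,
    coroot'_twoRhoN_eq_zero P pos hstab]
  simp

/-- (4) `Δ_c`-regularity is invariant under the compact Weyl group `W_c = ⟨s_α : α ∈ Φ_c⟩`, provided
`Φ_c` is closed under its own reflections. -/
theorem regular_iff_of_mem_compactWeyl {cpt : ι → Prop}
    (hcc : ∀ i k, cpt i → cpt k → cpt (P.reflectionPerm k i)) {v : M ≃ₗ[R] M}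
    (hv : v ∈ Subgroup.closure (P.reflection '' {k | cpt k})) :
    ∀ y : M, (∀ i, cpt i → P.coroot' i y ≠ 0) ↔ (∀ i, cpt i → P.coroot' i (v y) ≠ 0) := by
  induction hv using Subgroup.closure_induction with
  | mem x hx =>
    obtain ⟨k, hk, rfl⟩ := hx
    have key : ∀ y : M, (∀ i, cpt i → P.coroot' i y ≠ 0) →
        ∀ i, cpt i → P.coroot' i (P.reflection k y) ≠ 0 := by
      intro y hreg i hi
      rw [P.coroot'_reflection]
      exact hreg _ (hcc i k hi hk)
    intro y
    refine ⟨key y, fun h => ?_⟩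
    have h' := key _ h
    rwa [P.reflection_same] at h'
  | one => intro y; exact Iff.rfl
  | mul x z _ _ ihx ihz => intro y; rw [LinearEquiv.mul_apply]; exact (ihz y).trans (ihx (z y))
  | inv x _ ih =>
    intro y
    have hxy : x (x⁻¹ y) = y := by rw [← LinearEquiv.mul_apply, mul_inv_cancel]; rfl
    have h := ih (x⁻¹ y)
    rw [hxy] at h
    exact h.symm

/-- (5a) A vector orthogonal to every compact coroot is not `W_c`-conjugate to a `Δ_c`-regular vector,
as soon as there is a compact root. -/
theorem compactWeyl_apply_ne_of_singular {cpt : ι → Prop}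
    (hcc : ∀ i k, cpt i → cpt k → cpt (P.reflectionPerm k i)) (hne : ∃ i, cpt i) {x y : M}
    (hx : ∀ i, cpt i → P.coroot' i x = 0) (hy : ∀ i, cpt i → P.coroot' i y ≠ 0) {v : M ≃ₗ[R] M}
    (hv : v ∈ Subgroup.closure (P.reflection '' {k | cpt k})) : v y ≠ x := by
  obtain ⟨i, hi⟩ := hne
  intro h
  have hreg := (regular_iff_of_mem_compactWeyl P hcc hv y).mp hy i hi
  rw [h] at hreg
  exact hreg (hx i hi)

/-- **(5b) The weight-one lock, root-system half (LEMMA V modulo Casselman–Osborne).**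
On a Shimura host whose `K_h` has a root (`hne`), with `Φ_c` closed under its reflections (`hcc`)
and `Φ(𝔭⁺)` stable under them (`hstab`): for a CENTRAL parameter `lam = 2λ` (`hcent`), every
`w ∈ W`, every `v ∈ W_c` and every `Δ_c`-regular `y` (`= 2(μ + ρ_c)` for a `K_h`-type of highest
weight `μ`), `v y ≠ w lam + 2ρ_n` and `v y ≠ w lam - 2ρ_n`.  By [CO75, Thm. 2.6] the right-hand
sides exhaust (twice) the `Z(𝔨)`-characters of `H^*(𝔭^∓, π_∞)` for `π_∞` of infinitesimal
character `λ`; so no `K_h`-type occurs there and `H^*(𝔓_h, K_h; π_∞ ⊗ V) = 0` for all `V`. -/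
theorem weightOneLock [IsDomain R] [CharZero R] (pos : Finset ι) {cpt : ι → Prop}
    (hcc : ∀ i k, cpt i → cpt k → cpt (P.reflectionPerm k i))
    (hstab : ∀ i, cpt i → ∀ j ∈ pos, P.reflectionPerm i j ∈ pos) (hne : ∃ i, cpt i)
    {lam : M} (hcent : ∀ k, P.coroot' k lam = 0)
    {w : M ≃ₗ[R] M} (hw : w ∈ Subgroup.closure (Set.range P.reflection))
    {v : M ≃ₗ[R] M} (hv : v ∈ Subgroup.closure (P.reflection '' {k | cpt k}))
    {y : M} (hy : ∀ i, cpt i → P.coroot' i y ≠ 0) :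
    v y ≠ w lam + twoRhoN P pos ∧ v y ≠ w lam - twoRhoN P pos :=
  ⟨compactWeyl_apply_ne_of_singular P hcc hne
      (fun i hi => (coroot'_casselmanOsborne_eq_zero P pos hcent hw (hstab i hi)).1) hy hv,
    compactWeyl_apply_ne_of_singular P hcc hne
      (fun i hi => (coroot'_casselmanOsborne_eq_zero P pos hcent hw (hstab i hi)).2) hy hv⟩

end Summit.Langlands.Langlands.Theorems.SoloBlind
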